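import Summits.QuantumFields.BalabanUV.T4Continuum.Support.CTGaugeSlotDiffEnd
import Summits.QuantumFields.BalabanUV.T4Continuum.Support.CTAdmissibleRate

/-!
# T⁴ programme, spine node NE2 (U1a), sub-row Δ3 «NE2-WALK» (T4-DAG `T4-U1a.S-NE2-D3-WALK°`) — A SMALL-FIELD THRESHOLD `etaCT(|o|, d, a, a′) > 0`
# FOR THE «Δ3-CT» CHAIN (the four background binders `hγ hδU htK` + the rate window of `balaban_final_decayStations_of_regular_smallField`
# DISCHARGED by continuity at `α = 0` of the chain's closed-form constants, at the admissible rate `kappaCT`)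

NE2 formalisation swarm `b2b-balaban-t4-ne2-formalise-*`, leaf prover 06 (gen 4), supplier item «Δ3-CT-EXPLICIT» file 2 of 4 (file 1
`CTAdmissibleRate`: the rate `kappaCT`; chain «Δ3-CT» p220700 … «Δ3-CT-HBD-B4-DIFF» p227253).  Once the rate `κ` is fixed with
`0 < γ_U(0,0) − Jcov(0,0,κ)` and `deltaKU(0,0,κ) < σ₀²` (file 1), the remaining binders of gen 3's headline concern the BACKGROUND sizes `(α, β)` of
the (3.35)-class, with `τ(α) = e^{(d+1)α} − 1` the site-transport size:
  `hγ : 0 < γ_U(α,τ(α)) − Jcov(α,τ(α),κ)`, `hδU : deltaKU(α,τ(α),κ) < σ₀² − deltaKB(α,τ(α))`,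
  `htK : ‖t‖·(κ_CT(α,β) + κ_avg,CT(α) + kappa4CTd(α)) < 1`.
All constants are CLOSED FORMS, continuous in `α` at `0`; at `α = 0` the first two reduce to the two `κ`-binders and the coupling sum VANISHES except for
the part of row B2's `κ_CT` that is AFFINE in `β` (`κ_CT(α, β, d(α²+2β)) = AcolCT(α) + β·BcolCT`).  THIS FILE:
 * §1 values at `α = 0`: `tauR_zero`, `deltaKB_zero`, `dGDc_zero`, `dGc_zero`, `dZc_zero`, `dKc_zero`, `B4diff_zero`, **`kappa4CTd_zero`**, `GammaAvg_zero`,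
   **`kappaAvgCT_zero`**, the affine split **`kappaColCT_eq_affine`** (`AcolCT`, `BcolCT`), `AcolCT_zero`;
 * §2 continuity along `τ(α)` (`fun_prop` over local hypotheses; file 1's `continuousAt_K1_comp ∕ continuousAt_K2_comp`): everywhere
   `continuous_tauR ∕ continuous_gammaU ∕ continuous_Jcov ∕ continuous_cR ∕ continuous_GammaAvg ∕ continuous_kappaAvgCT ∕ continuous_AcolCT`,
   `gammaU_zero_ne`; AT `α = 0` `continuousAt_gR`, **`continuousAt_deltaKU`**, **`continuousAt_deltaKB`**, `continuousAt_dGDc ∕ continuousAt_dGc ∕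
   continuousAt_dZc ∕ continuousAt_dKc`, **`continuousAt_B4diff`** (at `σU = σ₀² − deltaKB(α,τ(α))`, `σ1 = σ₀²`), **`continuousAt_kappa4CTd`**;
 * §3 **`exists_smallFieldThreshold`**: for a fixed admissible `κ` and ANY `J`, `∃ η₁ > 0` with `η₁·BcolCT ≤ 1/4` and, for `0 ≤ α ≤ η₁`, `hγ`, `hδU`
   and `AcolCT(α) + κ_avg,CT(α) + kappa4CTd(α) < 1/4`; **`etaCT₀ co d a a′`** (`Classical.choose` at `κ = kappaCT`, `J = max (JA d a 1 κ 1) 0`)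
   with **`etaCT₀_spec`**; **`etaCT o d a a′ = min (etaStar o d a a′) (etaCT₀ |o| d a a′)`**, `etaCT_pos`, `etaCT_le_etaStar`, `etaCT_le_etaCT₀`;
 * §4 **`couplingSum_le_half`**: for `0 ≤ α, β ≤ etaCT₀`, `κ_CT + κ_avg,CT + kappa4CTd ≤ 1/2` at `(κ, J) = (kappaCT, max (JA d a 1 kappaCT 1) 0)` —
   so `‖t‖ ≤ 1` gives gen 3's `htK` with room `1/2` (the physical coupling `t = 1` is admissible).

HONEST FRAMING (T4-DAG p. 1).  Elementary real analysis over landed closed-form constants ([folklore]); `etaCT₀`, `etaCT` EXIST as definite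
functions of `(|o|, d, a, a′)` but are NOT extracted in closed form (no number claimed; `etaCT ≤ etaStar` by construction); statements and constants
OURS; MODEL level (no B0); nothing printed asserted; Δ3 NOT closed as a spine row; NE2 (U1a) NOT PROVED; spine PROVED 0/9 unchanged; NOT infinite
volume, NOT a mass gap, NOT the Clay problem, NOT summit progress.  HONEST DEPENDENCY: continuum YM on T⁴ ⇐ BetaPertH ∧ nine spine estimates (0/9
proved); BetaPertH ⇐ (D1) ∧ (D4) ∧ CAP+tail; G-an2-4 gates asym, D1 and NE2/3/4.  ABSOLUTE RULE kept; no `def … : Prop`; no `sorry`.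
-/

noncomputable section

open Filter Topology

namespace Summit.QuantumFields.BalabanUV.T4Continuum.CTSmallFieldThreshold

open Summit.QuantumFields.BalabanUV.T4Continuum
open Summit.QuantumFields.BalabanUV.T4Continuum.ScalarAveragedPropagator (gammaPs gammaPs_pos)
open Summit.QuantumFields.BalabanUV.T4Continuum.ScalarAveragedCompression (sigma0 sigma0_pos)
open Summit.QuantumFields.BalabanUV.T4Continuum.ScalarCovariantCoercive (gammaU Jcov)
open Summit.QuantumFields.BalabanUV.T4Continuum.DirichletRegionTower (gamD gamD_pos)
open Summit.QuantumFields.BalabanUV.T4Continuum.CTWeightedEnergy (K1 K2)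
open Summit.QuantumFields.BalabanUV.T4Continuum.CTVectorPropagator (JA)
open Summit.QuantumFields.BalabanUV.T4Continuum.CTConjugatedHbd (G2)
open Summit.QuantumFields.BalabanUV.T4Continuum.CTCovariantScalarGreen (cR)
open Summit.QuantumFields.BalabanUV.T4Continuum.CTGaugeUnitFactorHbd (gR deltaKU)
open Summit.QuantumFields.BalabanUV.T4Continuum.CTGaugeUnitDatum (deltaKB)
open Summit.QuantumFields.BalabanUV.T4Continuum.CTCovariantLaplacianDecay (kappaColCT)
open Summit.QuantumFields.BalabanUV.T4Continuum.CTAveragingSummandHbd (GammaAvg kappaAvgCT)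
open Summit.QuantumFields.BalabanUV.T4Continuum.CTGaugeSlotDiff (dGDc dGc dZc dKc B4diff kappa4CTd)
open Summit.QuantumFields.BalabanUV.T4Continuum.NE2BalabanThreshold (etaStar etaStar_pos)
open Summit.QuantumFields.BalabanUV.T4Continuum.CTAdmissibleRate

variable {d : ℕ}

/-- the site-transport size of the (3.35)-class, `τ(α) = e^{(d+1)α} − 1` (`RegularSiteTransporters.norm_siteT_sub_one_le`) — pure notation for gen 3's
literal spelling. -/
local notation "τR[" d ", " α "]" => Real.exp (((d + 1 : ℕ) : ℝ) * α) - 1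

/-! ## §1 Values at `α = 0` and the affine split of row B2's constant -/

section Zero

variable (d)

/-- `τ(0) = 0`. [folklore] -/
theorem tauR_zero : τR[d, (0 : ℝ)] = 0 := by simp

/-- `deltaKB(0, 0) = 0`. [folklore] -/
theorem deltaKB_zero (a' : ℝ) : deltaKB d a' 0 0 = 0 := by simp [deltaKB]

/-- `dGDc(0, 0, κ) = 0`. [folklore] -/
theorem dGDc_zero (co : ℕ) (a' κ : ℝ) : dGDc co d a' 0 0 κ = 0 := by simp [dGDc]

/-- `dGc(0, 0, κ) = 0`. [folklore] -/
theorem dGc_zero (co : ℕ) (a' κ : ℝ) : dGc co d a' 0 0 κ = 0 := by simp [dGc]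

/-- `dZc(0, 0, κ) = 0`. [folklore] -/
theorem dZc_zero (co : ℕ) (a' κ : ℝ) : dZc co d a' 0 0 κ = 0 := by simp [dZc, dGDc_zero]

/-- `dKc(0, 0, κ) = 0`. [folklore] -/
theorem dKc_zero (co : ℕ) (a' κ : ℝ) : dKc co d a' 0 0 κ = 0 := by simp [dKc, dGc_zero]

/-- `B4diff(0, 0, σU, σ1, κ) = 0`: the conjugated gauge-sandwich difference vanishes at zero background. [folklore] -/
theorem B4diff_zero (co : ℕ) (a' σU σ1 κ : ℝ) : B4diff co d a' 0 0 σU σ1 κ = 0 := by simp [B4diff, dZc_zero, dKc_zero]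

/-- **`kappa4CTd(α = 0) = 0`**: the gauge slot's conjugated constant in difference form vanishes at zero background. [folklore] -/
theorem kappa4CTd_zero (co : ℕ) (a a' J κ : ℝ) : kappa4CTd co d a a' 0 J κ = 0 := by simp [kappa4CTd, B4diff_zero]

/-- `GammaAvg(α = 0) = 0`. [folklore] -/
theorem GammaAvg_zero (co : ℕ) (κ : ℝ) : GammaAvg co d 0 κ = 0 := by simp [GammaAvg]

/-- **`κ_avg,CT(α = 0) = 0`**: row B3's conjugated constant vanishes at zero background. [folklore] -/
theorem kappaAvgCT_zero (co : ℕ) (a J κ : ℝ) : kappaAvgCT co d a 0 J κ = 0 := by simp [kappaAvgCT, GammaAvg_zero]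

/-- the `β`-free part of row B2's conjugated constant at `α′ = d(α² + 2β)`: `AcolCT = co²·(dαG₂ + de^{|κ|}αG₂ + dα²γw⁻¹)`. [folklore] -/
def AcolCT (co d : ℕ) (a α J κ : ℝ) : ℝ :=
  (co : ℝ) ^ 2 * (d * (α * G2 d a J (gamD d a - J) κ) + d * (Real.exp |κ| * (α * G2 d a J (gamD d a - J) κ))
    + d * α ^ 2 * (gamD d a - J)⁻¹)

/-- the `β`-slope of row B2's conjugated constant at `α′ = d(α² + 2β)`: `BcolCT = co²·(de^{|κ|}γw⁻¹ + 2dγw⁻¹)` (background-free). [folklore] -/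
def BcolCT (co d : ℕ) (a J κ : ℝ) : ℝ :=
  (co : ℝ) ^ 2 * (d * Real.exp |κ| * (gamD d a - J)⁻¹ + 2 * d * (gamD d a - J)⁻¹)

/-- **THE AFFINE SPLIT** `κ_CT(α, β, d(α²+2β)) = AcolCT(α) + β·BcolCT`. [folklore] -/
theorem kappaColCT_eq_affine (o : Type*) [Fintype o] (a α β J κ : ℝ) :
    kappaColCT o d a α β (d * (α ^ 2 + 2 * β)) J κ = AcolCT (Fintype.card o) d a α J κ + β * BcolCT (Fintype.card o) d a J κ := by
  unfold kappaColCT AcolCT BcolCT; ring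

/-- `AcolCT(α = 0) = 0`. [folklore] -/
theorem AcolCT_zero (co : ℕ) (a J κ : ℝ) : AcolCT co d a 0 J κ = 0 := by simp [AcolCT]

end Zero

/-! ## §2 Continuity at `α = 0` along `τ(α)` -/

section Continuity

variable (d)

/-- `α ↦ τ(α)` is continuous. [folklore] -/
theorem continuous_tauR : Continuous (fun α : ℝ => τR[d, α]) := by fun_prop

/-- `α ↦ γ_U(α, τ(α))` is continuous. [folklore] -/
theorem continuous_gammaU (a' : ℝ) : Continuous (fun α : ℝ => gammaU d a' α τR[d, α]) := by unfold gammaU; fun_prop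

/-- `α ↦ Jcov(α, τ(α), κ)` is continuous. [folklore] -/
theorem continuous_Jcov (co : ℕ) (a' κ : ℝ) : Continuous (fun α : ℝ => Jcov co d a' α τR[d, α] κ) := by unfold Jcov; fun_prop

/-- `α ↦ cR(α, κ)` is continuous. [folklore] -/
theorem continuous_cR (κ : ℝ) : Continuous (fun α : ℝ => cR d α κ) := by unfold cR; fun_prop

/-- `γ_U(0, 0) ≠ 0`. [folklore] -/
theorem gammaU_zero_ne (a' : ℝ) : gammaU d a' 0 0 ≠ 0 := by
  rw [show gammaU d a' 0 0 = gammaPs d a' / 2 by simp [gammaU]]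
  exact (half_pos (gammaPs_pos (d := d) (a' := a')).1).ne'

variable {d}

/-- the shared hypotheses of §2: a rate `κ` with `γw(0,0,κ) = γ_U(0,0) − Jcov(0,0,κ) ≠ 0`; the continuity facts every later constant uses. -/
private theorem basics (d co : ℕ) (a' κ : ℝ) (h1 : gammaU d a' 0 0 - Jcov co d a' 0 0 κ ≠ 0) :
    ContinuousAt (fun α : ℝ => gammaU d a' α τR[d, α] - Jcov co d a' α τR[d, α] κ) 0 ∧
    (gammaU d a' 0 τR[d, (0:ℝ)] - Jcov co d a' 0 τR[d, (0:ℝ)] κ ≠ 0) ∧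
    ContinuousAt (fun α : ℝ => K1 (gammaU d a' α τR[d, α] - Jcov co d a' α τR[d, α] κ) (Jcov co d a' α τR[d, α] κ) (cR d α κ)) 0 ∧
    ContinuousAt (fun α : ℝ => K2 (gammaU d a' α τR[d, α] - Jcov co d a' α τR[d, α] κ) (Jcov co d a' α τR[d, α] κ) (cR d α κ)) 0 ∧
    (gammaU d a' 0 τR[d, (0:ℝ)] ≠ 0) := by
  have hγ := (continuous_gammaU d a').continuousAt (x := (0 : ℝ))
  have hJ := (continuous_Jcov d co a' κ).continuousAt (x := (0 : ℝ))
  have hc := (continuous_cR d κ).continuousAt (x := (0 : ℝ))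
  have hF : ContinuousAt (fun α : ℝ => gammaU d a' α τR[d, α] - Jcov co d a' α τR[d, α] κ) 0 := hγ.sub hJ
  have h0 : gammaU d a' 0 τR[d, (0:ℝ)] - Jcov co d a' 0 τR[d, (0:ℝ)] κ ≠ 0 := by rw [tauR_zero]; exact h1
  have h0' : gammaU d a' 0 τR[d, (0:ℝ)] ≠ 0 := by rw [tauR_zero]; exact gammaU_zero_ne d a'
  exact ⟨hF, h0, continuousAt_K1_comp hF hJ hc h0, continuousAt_K2_comp hF hJ hc h0, h0'⟩

/-- `α ↦ gR(α, τ(α), κ)` is continuous at `0`. [folklore] -/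
theorem continuousAt_gR (co : ℕ) (a' κ : ℝ) (h1 : gammaU d a' 0 0 - Jcov co d a' 0 0 κ ≠ 0) :
    ContinuousAt (fun α : ℝ => gR co d a' α τR[d, α] κ) 0 := by
  obtain ⟨hF, h0, -, hK2, h0'⟩ := basics d co a' κ h1
  have hγ := (continuous_gammaU d a').continuousAt (x := (0 : ℝ))
  have hJ := (continuous_Jcov d co a' κ).continuousAt (x := (0 : ℝ))
  have hc := (continuous_cR d κ).continuousAt (x := (0 : ℝ))
  unfold gR
  fun_prop (disch := assumption)

/-- **`α ↦ deltaKU(α, τ(α), κ)` is continuous at `0`**. [folklore] -/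
theorem continuousAt_deltaKU (co : ℕ) (a' κ : ℝ) (h1 : gammaU d a' 0 0 - Jcov co d a' 0 0 κ ≠ 0) :
    ContinuousAt (fun α : ℝ => deltaKU co d a' α τR[d, α] κ) 0 := by
  obtain ⟨hF, h0, -, -, h0'⟩ := basics d co a' κ h1
  have hγ := (continuous_gammaU d a').continuousAt (x := (0 : ℝ))
  have hJ := (continuous_Jcov d co a' κ).continuousAt (x := (0 : ℝ))
  have hg := continuousAt_gR co a' κ h1
  unfold deltaKU
  fun_prop (disch := assumption)

/-- **`α ↦ deltaKB(α, τ(α))` is continuous at `0`**. [folklore] -/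
theorem continuousAt_deltaKB (a' : ℝ) : ContinuousAt (fun α : ℝ => deltaKB d a' α τR[d, α]) 0 := by
  have hγ := (continuous_gammaU d a').continuousAt (x := (0 : ℝ))
  have h0' : gammaU d a' 0 τR[d, (0:ℝ)] ≠ 0 := by rw [tauR_zero]; exact gammaU_zero_ne d a'
  unfold deltaKB
  fun_prop (disch := assumption)

/-- `α ↦ dGDc(α, τ(α), κ)` is continuous at `0`. [folklore] -/
theorem continuousAt_dGDc (co : ℕ) (a' κ : ℝ) (h1 : gammaU d a' 0 0 - Jcov co d a' 0 0 κ ≠ 0) :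
    ContinuousAt (fun α : ℝ => dGDc co d a' α τR[d, α] κ) 0 := by
  obtain ⟨hF, h0, -, hK2, -⟩ := basics d co a' κ h1
  unfold dGDc
  fun_prop (disch := assumption)

/-- `α ↦ dGc(α, τ(α), κ)` is continuous at `0`. [folklore] -/
theorem continuousAt_dGc (co : ℕ) (a' κ : ℝ) (h1 : gammaU d a' 0 0 - Jcov co d a' 0 0 κ ≠ 0) :
    ContinuousAt (fun α : ℝ => dGc co d a' α τR[d, α] κ) 0 := by
  obtain ⟨hF, h0, -, hK2, -⟩ := basics d co a' κ h1
  unfold dGc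
  fun_prop (disch := assumption)

/-- `α ↦ dZc(α, τ(α), κ)` is continuous at `0`. [folklore] -/
theorem continuousAt_dZc (co : ℕ) (a' κ : ℝ) (h1 : gammaU d a' 0 0 - Jcov co d a' 0 0 κ ≠ 0) :
    ContinuousAt (fun α : ℝ => dZc co d a' α τR[d, α] κ) 0 := by
  obtain ⟨hF, h0, -, hK2, -⟩ := basics d co a' κ h1
  have hG := continuousAt_dGDc co a' κ h1
  unfold dZc
  fun_prop (disch := assumption)

/-- `α ↦ dKc(α, τ(α), κ)` is continuous at `0`. [folklore] -/
theorem continuousAt_dKc (co : ℕ) (a' κ : ℝ) (h1 : gammaU d a' 0 0 - Jcov co d a' 0 0 κ ≠ 0) :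
    ContinuousAt (fun α : ℝ => dKc co d a' α τR[d, α] κ) 0 := by
  obtain ⟨hF, h0, -, -, -⟩ := basics d co a' κ h1
  have hG := continuousAt_dGc co a' κ h1
  unfold dKc
  fun_prop (disch := assumption)

/-- **`α ↦ B4diff(α, τ(α), σ₀² − deltaKB(α,τ(α)), σ₀², κ)` is continuous at `0`** whenever, besides `γw(0,0,κ) ≠ 0`,
`σ₀² − deltaKU(0,0,κ) ≠ 0` (the inverse `(σU − deltaKU)⁻¹` at `α = 0`). [folklore] -/
theorem continuousAt_B4diff (co : ℕ) (a' κ : ℝ) (h1 : gammaU d a' 0 0 - Jcov co d a' 0 0 κ ≠ 0)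
    (h5 : sigma0 d a' ^ 2 - deltaKU co d a' 0 0 κ ≠ 0) :
    ContinuousAt (fun α : ℝ => B4diff co d a' α τR[d, α] (sigma0 d a' ^ 2 - deltaKB d a' α τR[d, α]) (sigma0 d a' ^ 2) κ) 0 := by
  obtain ⟨hF, h0, -, hK2, -⟩ := basics d co a' κ h1
  have hJ := (continuous_Jcov d co a' κ).continuousAt (x := (0 : ℝ))
  have hc := (continuous_cR d κ).continuousAt (x := (0 : ℝ))
  have hZ := continuousAt_dZc co a' κ h1
  have hK := continuousAt_dKc co a' κ h1
  have hU := continuousAt_deltaKU co a' κ h1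
  have hB := continuousAt_deltaKB (d := d) a'
  have h5' : sigma0 d a' ^ 2 - deltaKB d a' 0 τR[d, (0:ℝ)] - deltaKU co d a' 0 τR[d, (0:ℝ)] κ ≠ 0 := by
    rw [tauR_zero, deltaKB_zero, sub_zero]; exact h5
  unfold B4diff
  fun_prop (disch := assumption)

/-- **`α ↦ kappa4CTd(α)` is continuous at `0`** (under the two side conditions of `continuousAt_B4diff`; `J` arbitrary). [folklore] -/
theorem continuousAt_kappa4CTd (co : ℕ) (a a' J κ : ℝ) (h1 : gammaU d a' 0 0 - Jcov co d a' 0 0 κ ≠ 0)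
    (h5 : sigma0 d a' ^ 2 - deltaKU co d a' 0 0 κ ≠ 0) : ContinuousAt (fun α : ℝ => kappa4CTd co d a a' α J κ) 0 := by
  have hB := continuousAt_B4diff co a' κ h1 h5
  unfold kappa4CTd
  fun_prop

/-- `α ↦ GammaAvg(α, κ)` is continuous. [folklore] -/
theorem continuous_GammaAvg (co : ℕ) (κ : ℝ) : Continuous (fun α : ℝ => GammaAvg co d α κ) := by unfold GammaAvg; fun_prop

/-- `α ↦ κ_avg,CT(α)` is continuous. [folklore] -/
theorem continuous_kappaAvgCT (co : ℕ) (a J κ : ℝ) : Continuous (fun α : ℝ => kappaAvgCT co d a α J κ) := by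
  have := continuous_GammaAvg (d := d) co κ
  unfold kappaAvgCT; fun_prop

/-- `α ↦ AcolCT(α)` is continuous. [folklore] -/
theorem continuous_AcolCT (co : ℕ) (a J κ : ℝ) : Continuous (fun α : ℝ => AcolCT co d a α J κ) := by unfold AcolCT; fun_prop

end Continuity

/-! ## §3 The small-field threshold -/

section Threshold

/-- **A SMALL-FIELD THRESHOLD EXISTS**: for a rate `κ` with `0 < γ_U(0,0) − Jcov(0,0,κ)` and `deltaKU(0,0,κ) < σ₀²` and ANY `J`, there is `η₁ > 0`
with `η₁·BcolCT ≤ 1/4` such that every `0 ≤ α ≤ η₁` satisfies `hγ`, `hδU` and `AcolCT(α) + κ_avg,CT(α) + kappa4CTd(α) < 1/4` — by continuity at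
`α = 0`, where the first two are the `κ`-binders and the third sum vanishes. [folklore] -/
theorem exists_smallFieldThreshold (d co : ℕ) (a a' κ J : ℝ) (h1 : 0 < gammaU d a' 0 0 - Jcov co d a' 0 0 κ)
    (h5 : deltaKU co d a' 0 0 κ < sigma0 d a' ^ 2) :
    ∃ η₁ : ℝ, 0 < η₁ ∧ η₁ * BcolCT co d a J κ ≤ 1 / 4 ∧ ∀ α : ℝ, 0 ≤ α → α ≤ η₁ →
      0 < gammaU d a' α τR[d, α] - Jcov co d a' α τR[d, α] κ ∧
      deltaKU co d a' α τR[d, α] κ < sigma0 d a' ^ 2 - deltaKB d a' α τR[d, α] ∧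
      AcolCT co d a α J κ + kappaAvgCT co d a α J κ + kappa4CTd co d a a' α J κ < 1 / 4 := by
  have h1' : gammaU d a' 0 0 - Jcov co d a' 0 0 κ ≠ 0 := h1.ne'
  have h5' : sigma0 d a' ^ 2 - deltaKU co d a' 0 0 κ ≠ 0 := (sub_pos.mpr h5).ne'
  obtain ⟨hF, -, -, -, -⟩ := basics d co a' κ h1'
  have e1 : ∀ᶠ α : ℝ in 𝓝 0, 0 < gammaU d a' α τR[d, α] - Jcov co d a' α τR[d, α] κ :=
    continuousAt_const.eventually_lt hF (by rw [tauR_zero]; exact h1)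
  have e2 : ∀ᶠ α : ℝ in 𝓝 0, deltaKU co d a' α τR[d, α] κ < sigma0 d a' ^ 2 - deltaKB d a' α τR[d, α] := by
    have hB := continuousAt_deltaKB (d := d) a'
    have hc : ContinuousAt (fun α : ℝ => sigma0 d a' ^ 2 - deltaKB d a' α τR[d, α]) 0 := by fun_prop
    exact (continuousAt_deltaKU co a' κ h1').eventually_lt hc (by rw [tauR_zero, deltaKB_zero, sub_zero]; exact h5)
  have e3 : ∀ᶠ α : ℝ in 𝓝 0, AcolCT co d a α J κ + kappaAvgCT co d a α J κ + kappa4CTd co d a a' α J κ < 1 / 4 := by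
    have hA := (continuous_AcolCT (d := d) co a J κ).continuousAt (x := (0 : ℝ))
    have hB := (continuous_kappaAvgCT (d := d) co a J κ).continuousAt (x := (0 : ℝ))
    have hC := continuousAt_kappa4CTd co a a' J κ h1' h5'
    have hs : ContinuousAt (fun α : ℝ => AcolCT co d a α J κ + kappaAvgCT co d a α J κ + kappa4CTd co d a a' α J κ) 0 := by fun_prop
    exact hs.eventually_lt continuousAt_const (by rw [AcolCT_zero, kappaAvgCT_zero, kappa4CTd_zero]; norm_num)
  obtain ⟨ε, hε, hball⟩ := Metric.eventually_nhds_iff.mp (e1.and (e2.and e3))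
  set B : ℝ := BcolCT co d a J κ
  have hden : 0 < 4 * |B| + 4 := by positivity
  refine ⟨min (ε / 2) (1 / (4 * |B| + 4)), lt_min (half_pos hε) (by positivity), ?_, fun α hα0 hα1 => ?_⟩
  · have hη0 : 0 ≤ min (ε / 2) (1 / (4 * |B| + 4)) := (lt_min (half_pos hε) (by positivity)).le
    calc min (ε / 2) (1 / (4 * |B| + 4)) * B ≤ min (ε / 2) (1 / (4 * |B| + 4)) * |B| := mul_le_mul_of_nonneg_left (le_abs_self B) hη0
      _ ≤ 1 / (4 * |B| + 4) * |B| := mul_le_mul_of_nonneg_right (min_le_right _ _) (abs_nonneg B)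
      _ ≤ 1 / 4 := by
          rw [div_mul_eq_mul_div, one_mul, div_le_iff₀ hden]
          nlinarith [abs_nonneg B]
  · have hmem : dist α (0 : ℝ) < ε := by
      rw [Real.dist_eq, sub_zero, abs_of_nonneg hα0]
      exact lt_of_le_of_lt (hα1.trans (min_le_left _ _)) (half_lt_self hε)
    exact hball hmem

/-- **THE COMBES–THOMAS SMALL-FIELD THRESHOLD `etaCT₀(|o|, d, a, a′)`** of the «Δ3-CT» chain at `κ = kappaCT`, `J = max (JA d a 1 κ 1) 0`
(a definite function of its arguments by `Classical.choose`; `1` off the domain `0 < a′`; NOT a closed form). [folklore] -/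
def etaCT₀ (co d : ℕ) (a a' : ℝ) : ℝ :=
  if h : 0 < a' then
    Classical.choose (exists_smallFieldThreshold d co a a' (kappaCT co d a a') (max (JA d a 1 (kappaCT co d a a') 1) 0)
      (kappaCT_spec co d a h).2.2.2.2.2.1 (kappaCT_spec co d a h).2.2.2.2.2.2)
  else 1

/-- **THE BACKGROUND BINDERS HOLD BELOW `etaCT₀`** at `(κ, J) = (kappaCT, max (JA d a 1 kappaCT 1) 0)`. [folklore] -/
theorem etaCT₀_spec (co d : ℕ) (a : ℝ) {a' : ℝ} (ha' : 0 < a') :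
    0 < etaCT₀ co d a a' ∧
    etaCT₀ co d a a' * BcolCT co d a (max (JA d a 1 (kappaCT co d a a') 1) 0) (kappaCT co d a a') ≤ 1 / 4 ∧
    ∀ α : ℝ, 0 ≤ α → α ≤ etaCT₀ co d a a' →
      0 < gammaU d a' α τR[d, α] - Jcov co d a' α τR[d, α] (kappaCT co d a a') ∧
      deltaKU co d a' α τR[d, α] (kappaCT co d a a') < sigma0 d a' ^ 2 - deltaKB d a' α τR[d, α] ∧
      AcolCT co d a α (max (JA d a 1 (kappaCT co d a a') 1) 0) (kappaCT co d a a')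
        + kappaAvgCT co d a α (max (JA d a 1 (kappaCT co d a a') 1) 0) (kappaCT co d a a')
        + kappa4CTd co d a a' α (max (JA d a 1 (kappaCT co d a a') 1) 0) (kappaCT co d a a') < 1 / 4 := by
  rw [etaCT₀, dif_pos ha']
  exact Classical.choose_spec (exists_smallFieldThreshold d co a a' (kappaCT co d a a') (max (JA d a 1 (kappaCT co d a a') 1) 0)
    (kappaCT_spec co d a ha').2.2.2.2.2.1 (kappaCT_spec co d a ha').2.2.2.2.2.2)

/-- `0 < etaCT₀`. [folklore] -/
theorem etaCT₀_pos (co d : ℕ) (a : ℝ) {a' : ℝ} (ha' : 0 < a') : 0 < etaCT₀ co d a a' := (etaCT₀_spec co d a ha').1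

/-- **THE SMALL-FIELD THRESHOLD OF RECORD FOR THE DECAY CURRENCY**: `etaCT o d a a′ = min (etaStar o d a a′) (etaCT₀ |o| d a a′)` — ROOT B's own
threshold `η⋆` (`NE2BalabanThreshold.etaStar`) capped by the Combes–Thomas threshold. [folklore] -/
def etaCT (o : Type*) [Fintype o] (d : ℕ) (a a' : ℝ) : ℝ := min (etaStar o d a a') (etaCT₀ (Fintype.card o) d a a')

/-- `etaCT ≤ etaStar`. [folklore] -/
theorem etaCT_le_etaStar (o : Type*) [Fintype o] (d : ℕ) (a a' : ℝ) : etaCT o d a a' ≤ etaStar o d a a' := min_le_left _ _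

/-- `etaCT ≤ etaCT₀`. [folklore] -/
theorem etaCT_le_etaCT₀ (o : Type*) [Fintype o] (d : ℕ) (a a' : ℝ) : etaCT o d a a' ≤ etaCT₀ (Fintype.card o) d a a' := min_le_right _ _

/-- `0 < etaCT` for `a ≥ 0`, `a′ > 0`. [folklore] -/
theorem etaCT_pos (o : Type*) [Fintype o] (d : ℕ) {a a' : ℝ} (ha : 0 ≤ a) (ha' : 0 < a') : 0 < etaCT o d a a' :=
  lt_min (etaStar_pos (o := o) (d := d) a ha ha'.le) (etaCT₀_pos (Fintype.card o) d a ha')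

end Threshold

/-! ## §4 The coupling sum below the threshold -/

section Coupling

/-- **THE COUPLING SUM IS AT MOST `1/2` BELOW THE THRESHOLD**: for background sizes `0 ≤ α, β ≤ etaCT₀`, at `(κ, J) = (kappaCT, max (JA d a 1 κ 1) 0)`,
`κ_CT(α, β, d(α²+2β)) + κ_avg,CT(α) + kappa4CTd(α) ≤ 1/2` — gen 3's coupling condition `htK` then holds for every `‖t‖ ≤ 1` with room `1/2`. [folklore] -/
theorem couplingSum_le_half (o : Type*) [Fintype o] (d : ℕ) (a : ℝ) {a' α β : ℝ} (ha' : 0 < a') (hα : 0 ≤ α) (hβ : 0 ≤ β)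
    (hαη : α ≤ etaCT₀ (Fintype.card o) d a a') (hβη : β ≤ etaCT₀ (Fintype.card o) d a a') :
    kappaColCT o d a α β (d * (α ^ 2 + 2 * β)) (max (JA d a 1 (kappaCT (Fintype.card o) d a a') 1) 0) (kappaCT (Fintype.card o) d a a')
      + kappaAvgCT (Fintype.card o) d a α (max (JA d a 1 (kappaCT (Fintype.card o) d a a') 1) 0) (kappaCT (Fintype.card o) d a a')
      + kappa4CTd (Fintype.card o) d a a' α (max (JA d a 1 (kappaCT (Fintype.card o) d a a') 1) 0) (kappaCT (Fintype.card o) d a a')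
      ≤ 1 / 2 := by
  obtain ⟨hη0, hB, hall⟩ := etaCT₀_spec (Fintype.card o) d a ha'
  obtain ⟨-, -, hA⟩ := hall α hα hαη
  rw [kappaColCT_eq_affine]
  set B := BcolCT (Fintype.card o) d a (max (JA d a 1 (kappaCT (Fintype.card o) d a a') 1) 0) (kappaCT (Fintype.card o) d a a')
  have hβB : β * B ≤ 1 / 4 := by
    rcases le_total 0 B with hB0 | hB0
    · exact (mul_le_mul_of_nonneg_right hβη hB0).trans hB
    · have : β * B ≤ 0 := mul_nonpos_of_nonneg_of_nonpos hβ hB0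
      linarith
  linarith

end Coupling

end Summit.QuantumFields.BalabanUV.T4Continuum.CTSmallFieldThreshold

end
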